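import Literature.AlgebraicGeometry.Resolution.Hironaka1964LocalCartier
import Literature.AlgebraicGeometry.Limits.IdealSheafExtension
import HarnessLib

/-!
# The Cartier case of `Hironaka1964_local` is local on affine charts where the divisor is principal

Topic: `Literature/AlgebraicGeometry/Resolution`. Companion of `Hironaka1964LocalCartier.lean`
(proofs only: no new notions, no new named facts). There the named fact `Hironaka1964_local`
(Hironaka 1964, Main Theorem I, over local quasi-excellent rings of residue characteristic zero,
as read by Temkin 2008) was reduced (`hironaka1964_local_of_cartier`) to

  (C) the Cartier case: for every integral Noetherian quasi-excellent scheme `X` whose residue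
      fields have characteristic zero and every effective Cartier divisor `D ⊆ X` containing
      `X_sing` which is, as a closed subscheme, of finite type over a field, there is a blow-up
      `X'' → X` centred in `D` with `X''` regular,

the output of Temkin's Cor. 3.4.2 once `Z = D` is Cartier, which the source obtains by completing
`X` along `D` and invoking Thm. 3.4.1 (desingularization of rig-regular special formal schemes
with a locally principal ideal of definition). The proof of Thm. 3.4.1 (p. 18) is a Noetherian
induction which enlarges, chart by chart, the open set over which the current blow-up is already
desingularized: "Assume that `f̂` … desingularizes … over an open formal subscheme `𝔘` with
`𝔛 ∖ 𝔗 ⊆ 𝔘 ⊊ 𝔛` … it suffices to prove that there exists a `𝔗`-supported formal blow up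
`𝔛'' → 𝔛`, which desingularizes `𝔛` over an open formal subscheme `𝔚` with `𝔘 ⊊ 𝔚`. … Find an
open affine subscheme `𝔛₀` which possesses a principal ideal of definition and has a non-empty
intersection with the set `𝔖 = 𝔛 ∖ 𝔘` … [desingularize `𝔛'₀ = 𝔛₀ ×_𝔛 𝔛'` by algebraization
and resolution of varieties] … we can extend `f̂'₀` to an `𝔖`-supported formal blow up
`f̂' : 𝔛'' → 𝔛'` … Therefore, `f̂ ∘ f̂'` … desingularizes `𝔛` over `𝔚 = 𝔘 ∪ 𝔛₀`." Only the
bracketed local step uses formal geometry. This file runs the induction on the scheme `X` itself,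
sorry-free, and thereby reduces (C) to its chart-local core

  (C₀) **the principal affine chart case**: for `X`, `D` as in (C), every affine open `U ⊆ X` on
       which `D` is generated by one non-zero-divisor, and every `D`-supported blow-up
       `p : X' → X`, the open piece `p⁻¹(U)` of `X'` admits a desingularization (a blow-up
       centred in its singular locus, with regular source)

— exactly what the local step of Thm. 3.4.1 delivers for `𝔛₀ = Û` (completion along the
principal ideal of `D`), `𝔛'₀ = p⁻¹(U)^`.

* `cartier_of_charts` — **(C₀) ⟹ (C)**: well-founded induction on the closed set `C ⊆ Supp D`
  over which the current `D`-supported blow-up `f : X' → X` may still be singular (start: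
  `C = X_sing`, `f = 𝟙`). Step: pick a non-regular `x₁ ∈ X'`, so `x = f(x₁) ∈ C`, and an affine
  open `V ∋ x` with `D|_V` principal (`IsEffectiveCartier`); (C₀) desingularizes `W = f⁻¹(V)` by
  a blow-up along `𝓘'` centred in `W_sing ⊆ f⁻¹(C)`; extend `𝓘'` to `𝓙' = ι_*𝓘' ∩ 𝒪_{X'}` on
  `X'` (`comap_map_of_isOpenImmersion`, support the closure, still inside `f⁻¹(C) ⊆ f⁻¹(Supp D)`);
  `X'' = Bl_{𝓙'}(X') → X' → X` is a `D`-supported blow-up (Temkin's Lemma 2.1.4 =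
  `IsBlowup.exists_isBlowup_comp_supported`); `X''` is regular off `C' = C ∖ V`: over `X ∖ C`
  because `X'` is regular there and `X'' → X'` is an isomorphism off `Supp 𝓙'`
  (`IsBlowup.isIso_compl`), over `V` because `X'' ×_{X'} W` is the blow-up of `W` along `𝓘'`
  (`IsBlowup.restrict`), i.e. the regular scheme provided by (C₀) (uniqueness of blow-ups); and
  `C' ⊊ C` as `x ∈ C ∩ V`.
* `hironaka1964_local_of_charts` — **(C₀) ⟹ `Hironaka1964_local`**
  (with `hironaka1964_local_of_cartier`).

No named fact is introduced: (C₀) appears only as a hypothesis.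

## Sources

* M. Temkin, *Desingularization of quasi-excellent schemes in characteristic zero*, Adv. Math.
  219 (2008) 488–522 = arXiv:math/0703678 (arXiv pagination): Lemma 2.1.4 (p. 7), Thm. 3.4.1 and
  its proof (p. 18), Cor. 3.4.2 (p. 18–19), Thm. 3.4.3 (p. 19). [Temkin2008]
* H. Hironaka, *Resolution of singularities of an algebraic variety over a field of
  characteristic zero I*, Ann. of Math. 79 (1964) 109–203, Main Theorem I. [Hironaka1964]
-/

noncomputable section

open CategoryTheory CategoryTheory.Limits AlgebraicGeometry TopologicalSpace IsLocalRing

namespace Literature.AlgebraicGeometry.Resolution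

universe u

/-- **The Cartier case (C) is local on affine charts where the divisor is principal** (the
Noetherian induction of Temkin 2008, proof of Thm. 3.4.1, p. 18, run on the scheme): let `X` be
an integral Noetherian quasi-excellent scheme with residue fields of characteristic zero and `D`
an effective Cartier divisor containing `X_sing`, of finite type over a field. If for every
affine open `U` on which `D` is generated by a single non-zero-divisor and every `D`-supported
blow-up `p : X' → X` the open piece `p⁻¹(U)` admits a desingularization (hypothesis `hch`, the
chart-local case (C₀)), then `X` admits a `D`-supported blow-up with regular source. Induction
on the closed set `C ⊆ Supp D` off which the current `D`-supported blow-up `f : X' → X` is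
regular: desingularize `W = f⁻¹(V)` for an affine `V ∋ x = f(x₁)`, `x₁` singular, with `D|_V`
principal; extend the centre `𝓘'` from the open `W` to `𝓙'` on `X'`
(`comap_map_of_isOpenImmersion`; `Supp 𝓙' ⊆ f⁻¹(C)`); blow up and compose (Lemma 2.1.4,
`IsBlowup.exists_isBlowup_comp_supported`); the result is regular off `C ∖ V ⊊ C`
(`IsBlowup.isIso_compl` off `C`; `IsBlowup.restrict` and uniqueness of blow-ups over `V`).
[cite: Temkin2008, Thm. 3.4.1 (proof, p. 18) and Lemma 2.1.4] -/
theorem cartier_of_charts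
    (hch : ∀ (X : Scheme.{u}) [IsIntegral X] [IsNoetherian X], Scheme.IsQuasiExcellent X →
      (∀ x : X, CharZero (X.residueField x)) →
      ∀ (D : X.IdealSheafData), IsEffectiveCartier D →
        (Scheme.regularLocus X)ᶜ ⊆ (D.support : Set X) →
        (∃ (k : Type u) (_ : Field k) (q : D.subscheme ⟶ Spec (.of k)),
            LocallyOfFiniteType q ∧ QuasiCompact q) →
        ∀ (U : X.affineOpens),
          (∃ g : Γ(X, U), g ∈ nonZeroDivisors Γ(X, U) ∧ D.ideal U = Ideal.span {g}) →
          ∀ (X' : Scheme.{u}) (p : X' ⟶ X) (P : X.IdealSheafData), IsBlowup p P →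
            (P.support : Set X) ⊆ D.support →
            Scheme.AdmitsDesingularization (↑(p ⁻¹ᵁ (U : X.Opens)) : Scheme.{u}))
    (X : Scheme.{u}) [IsIntegral X] [IsNoetherian X] (hqe : Scheme.IsQuasiExcellent X)
    (hchar : ∀ x : X, CharZero (X.residueField x)) (D : X.IdealSheafData)
    (hD : IsEffectiveCartier D) (hsingD : (Scheme.regularLocus X)ᶜ ⊆ (D.support : Set X))
    (hfin : ∃ (k : Type u) (_ : Field k) (q : D.subscheme ⟶ Spec (.of k)),
      LocallyOfFiniteType q ∧ QuasiCompact q) :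
    ∃ (X'' : Scheme.{u}) (f : X'' ⟶ X) (J : X.IdealSheafData),
      IsBlowup f J ∧ (J.support : Set X) ⊆ D.support ∧ Scheme.IsRegular X'' := by
  set T : Set X := (D.support : Set X) with hT
  have hRc : IsClosed (Scheme.regularLocus X)ᶜ :=
    isClosed_compl_regularLocus_of_locallyOfFiniteType (𝟙 X) hqe
  -- the induction statement
  suffices H : ∀ C : Closeds X, (C : Set X) ⊆ T →
      (∃ (X' : Scheme.{u}) (f : X' ⟶ X) (J : X.IdealSheafData), IsBlowup f J ∧
        (J.support : Set X) ⊆ T ∧ ∀ x' : X', f x' ∉ C → x' ∈ Scheme.regularLocus X') →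
      ∃ (X'' : Scheme.{u}) (f : X'' ⟶ X) (J : X.IdealSheafData),
        IsBlowup f J ∧ (J.support : Set X) ⊆ T ∧ Scheme.IsRegular X'' by
    refine H ⟨(Scheme.regularLocus X)ᶜ, hRc⟩ hsingD ⟨X, 𝟙 X, ⊤, isBlowup_id_top X, ?_, ?_⟩
    · simp [Scheme.IdealSheafData.support_top]
    · intro x' hx'
      simpa using hx'
  intro C
  induction C using WellFoundedLT.induction with
  | ind C ih =>
  intro hCT ⟨X', f, J, hf, hJ, hreg⟩
  -- either `X'` is already regular …
  by_cases hall : ∀ x' : X', x' ∈ Scheme.regularLocus X'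
  · exact ⟨X', f, J, hf, hJ, fun x' => (Scheme.mem_regularLocus x').mp (hall x')⟩
  -- … or some `x₁ ∈ X'` is singular, and `x = f x₁ ∈ C`
  push Not at hall
  obtain ⟨x₁, hx₁⟩ := hall
  have hx₁C : f x₁ ∈ (C : Set X) := by
    by_contra h
    exact hx₁ (hreg x₁ h)
  -- an affine open neighbourhood `V` of `x` on which `D` is principal
  obtain ⟨V, hxV, g, hg, hDV⟩ := hD (f x₁)
  -- `X'` is Noetherian
  haveI : IsProper f := hf.isProper
  haveI : IsLocallyNoetherian X' := LocallyOfFiniteType.isLocallyNoetherian f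
  haveI : CompactSpace X' := QuasiCompact.compactSpace_of_compactSpace f
  haveI : IsNoetherian X' := {}
  -- the open piece `W = f⁻¹(V)` of `X'` and its desingularization (the chart-local case)
  set W : X'.Opens := f ⁻¹ᵁ (V : X.Opens) with hW
  obtain ⟨X''₀, q, hdes⟩ := hch X hqe hchar D hD hsingD hfin V ⟨g, hg, hDV⟩ X' f J hf hJ
  obtain ⟨I', hq, hI'⟩ := hdes.exists_isBlowup
  have hregq := hdes.isRegular
  -- extend the centre `I'` from the open `W` to `J'` on `X'`
  haveI : QuasiCompact W.ι :=
    Literature.AlgebraicGeometry.Limits.quasiCompact_ι_of_isCompact W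
      (NoetherianSpace.isCompact _)
  set J' : X'.IdealSheafData := I'.map W.ι with hJ'
  have hJ'I' : J'.comap W.ι = I' :=
    Literature.AlgebraicGeometry.Limits.comap_map_of_isOpenImmersion W.ι I'
  have hJ'supp : (J'.support : Set X') = closure (W.ι '' (I'.support : Set W)) := by
    rw [hJ', Scheme.IdealSheafData.support_map]; rfl
  -- its support lies over `C` (the centre lies in `W_sing ⊆ X'_sing ⊆ f⁻¹(C)`, a closed set)
  have hI'C : W.ι '' (I'.support : Set W) ⊆ f ⁻¹' (C : Set X) := by
    rintro _ ⟨w, hw, rfl⟩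
    have h1 : W.ι w ∉ Scheme.regularLocus X' := fun h =>
      hI' hw ((mem_regularLocus_iff_of_flat_of_isPreimmersion W.ι w).mpr h)
    by_contra h2
    exact h1 (hreg _ h2)
  have hJ'C : (J'.support : Set X') ⊆ f ⁻¹' (C : Set X) := by
    rw [hJ'supp]
    exact (C.isClosed.preimage f.continuous).closure_subset_iff.mpr hI'C
  have hJ'T : (J'.support : Set X') ⊆ f ⁻¹' T := hJ'C.trans (Set.preimage_mono hCT)
  -- blow up `X'` along `J'`; the composite is a `T`-supported blow-up of `X` (Lemma 2.1.4)
  obtain ⟨X'', f', hf'⟩ := exists_isBlowup X' J'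
  obtain ⟨J₂, hf₂, hJ₂⟩ := IsBlowup.exists_isBlowup_comp_supported f J f' J' T hf hJ hf' hJ'T
  -- the new, smaller, closed set `C' = C ∖ V`
  let C' : Closeds X :=
    ⟨(C : Set X) ∩ ((V : X.Opens) : Set X)ᶜ, C.isClosed.inter (V : X.Opens).isOpen.isClosed_compl⟩
  have hlt : C' < C := by
    refine lt_of_le_of_ne (fun y hy => hy.1) fun h => ?_
    have hx' : f x₁ ∈ (C' : Set X) := by
      rw [h]
      exact hx₁C
    exact hx'.2 hxV
  refine ih C' hlt (fun y hy => hCT hy.1) ⟨X'', f' ≫ f, J₂, hf₂, hJ₂, fun x'' hx'' => ?_⟩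
  rw [Scheme.Hom.comp_apply] at hx''
  by_cases hyC : f (f' x'') ∈ (C : Set X)
  · -- over `C ∩ V`: `X'' ×_{X'} W` is the blow-up of `W` along `I'`, i.e. the regular `X''₀`
    have hyV : f (f' x'') ∈ (V : X.Opens) := by
      by_contra h
      exact hx'' ⟨hyC, h⟩
    have hmem : x'' ∈ f' ⁻¹ᵁ W := hyV
    have hres : IsBlowup (f' ∣_ W) I' := by
      rw [← hJ'I']
      exact hf'.restrict W
    obtain ⟨e, -, -⟩ := hres.unique hq
    have key : (⟨x'', hmem⟩ : ↥(f' ⁻¹ᵁ W)) ∈ Scheme.regularLocus (↑(f' ⁻¹ᵁ W) : Scheme.{u}) :=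
      (mem_regularLocus_iff_of_flat_of_isPreimmersion e.hom _).mpr (hregq _)
    exact (mem_regularLocus_iff_of_flat_of_isPreimmersion (f' ⁻¹ᵁ W).ι ⟨x'', hmem⟩).mp key
  · -- over `X ∖ C`: `X'` is regular there and `f'` is an isomorphism off its centre
    have h1 : f' x'' ∈ Scheme.regularLocus X' := hreg _ hyC
    have h2 : f' x'' ∉ (J'.support : Set X') := fun h => hyC (hJ'C h)
    haveI := hf'.isIso_compl
    exact (mem_regularLocus_iff_of_isIso_morphismRestrict f'
      ⟨(J'.support : Set X')ᶜ, J'.support.isClosed.isOpen_compl⟩ x'' h2).mpr h1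

/-- **The principal affine chart case (C₀) implies `Hironaka1964_local`**: resolution of
singularities over every local quasi-excellent ring of residue characteristic zero (Hironaka
1964, Main Theorem I, as read by Temkin 2008) follows — through the local desingularization
problem (L) (`hironaka1964_local_iff_isBlowup_local`), the Cartier case (C)
(`hironaka1964_local_of_cartier`) and the chart induction (`cartier_of_charts`) — from the
statement that for an integral Noetherian quasi-excellent scheme `X` with residue fields of
characteristic zero, an effective Cartier divisor `D ⊇ X_sing` of finite type over a field, an
affine open `U` with `D|_U` principal and a `D`-supported blow-up `X' → X`, the open piece of
`X'` over `U` admits a desingularization: the local step of Temkin's proof of Thm. 3.4.1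
(completion along `D|_U`, algebraization, resolution of varieties in characteristic zero).
[cite: Temkin2008, Thm. 3.4.3, Cor. 3.4.2, Thm. 3.4.1] [cite: Hironaka1964, Main Theorem I] -/
theorem hironaka1964_local_of_charts
    (hch : ∀ (X : Scheme.{u}) [IsIntegral X] [IsNoetherian X], Scheme.IsQuasiExcellent X →
      (∀ x : X, CharZero (X.residueField x)) →
      ∀ (D : X.IdealSheafData), IsEffectiveCartier D →
        (Scheme.regularLocus X)ᶜ ⊆ (D.support : Set X) →
        (∃ (k : Type u) (_ : Field k) (q : D.subscheme ⟶ Spec (.of k)),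
            LocallyOfFiniteType q ∧ QuasiCompact q) →
        ∀ (U : X.affineOpens),
          (∃ g : Γ(X, U), g ∈ nonZeroDivisors Γ(X, U) ∧ D.ideal U = Ideal.span {g}) →
          ∀ (X' : Scheme.{u}) (p : X' ⟶ X) (P : X.IdealSheafData), IsBlowup p P →
            (P.support : Set X) ⊆ D.support →
            Scheme.AdmitsDesingularization (↑(p ⁻¹ᵁ (U : X.Opens)) : Scheme.{u})) :
    Hironaka1964_local.{u} :=
  hironaka1964_local_of_cartier fun X _ _ hqe hchar D hD hsingD hfin =>
    cartier_of_charts hch X hqe hchar D hD hsingD hfin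

end Literature.AlgebraicGeometry.Resolution

end
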